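import Summits.AtomisticToContinuum.Crystallization.Theorems.FrustrationRangeCertificatesCertificatesDefectVanish
import Literature.MathematicalPhysics.StatisticalMechanics.TransferLevelValue

/-!
# Transfer duality for level-`L` pattern-priced certificates — the elementary half

Support lemmas for the informal item stmt-AtomisticToContinuum-12737 (`TransferDuality`) of route
`FrustrationRangeCertificates` (sub-problem `Crystallization` of `AtomisticToContinuum`).

The certificates of this route (`PatternPricedCertificates`, and the dual value `v_L(κ)` of the
item) use **pattern-local transfer rules of UNBOUNDED range**: particle `i` receives
`Σ_{j ≠ i} [Φ(x_j − x_i, pat_L i, pat_L j) − Φ(x_i − x_j, pat_L j, pat_L i)]`, the sum running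
over ALL other particles `j` (the two `L`-patterns are local, the displacement is not), whereas
the Literature notion `IsTransferCertificate` / `transferSum` of
`Literature.MathematicalPhysics.StatisticalMechanics.TransferLevelValue` cuts the transfers at
range `L` (`if dist (x i) (x j) ≤ L`). The pattern map is the same: the route's
`pat i = Finset.image (fun k => x k - x i) (univ.filter fun k => k ≠ i ∧ dist (x i) (x k) ≤ L)`
is `relPattern L x i` on the nose (`transferDuality_relPattern_eq`).

For the unbounded-range rules we prove the two elementary facts of the item:

* `transferDuality_weak_finite` (+ `_div`) — claim (i), WEAK DUALITY in finite volume: if `Φ`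
  certifies `c` with price `κ` on the bad particles of a finite configuration, then
  `N·c + κ·#bad ≤ 𝓔_N(x)` (the transfers are zero-sum; this is weak duality against the
  uniformly rooted empirical law of the configuration, which is point-stationary);
* `transferDuality_level_mono` (+ the literal form `transferDuality_level_mono'`) — the
  monotonicity half of claim (ii): whatever an unbounded-range rule certifies from level-`L`
  patterns is certified from level-`L'` patterns, `L ≤ L'`, by the rule
  `Φ' (v, p, q) := Φ (v, ballPattern L p, ballPattern L q)` (read the `L`-patterns off the
  `L'`-patterns, `ballPattern_relPattern`); hence `v_L(κ) ≤ v_{L'}(κ)`.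

* `transferDuality_transferSum_eq_cut` / `transferDuality_of_finiteRange` — the Literature's
  finite-range certificates are route certificates: cutting a rule at range `L`
  (`Φ_cut (v, p, q) := if ‖v‖ ≤ L then Φ (v, p, q) else 0`) turns `transferSum L Φ` into the
  route's unbounded-range balance, so every constant certified in the sense of
  `IsTransferCertificate` (in particular anything below `transferLevelValue`) is certified in the
  route's sense at the same level.

NOT here: the strong-duality / level-convergence half of the item (`lim_L v_L(κ) ≥ p(κ)` with the
fattened pattern event, against point-stationary laws `IsPointStationaryLaw`), which has no Lean
statement yet.
-/

open scoped BigOperators Classical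

namespace Summit.AtomisticToContinuum.Crystallization.Theorems

open Literature.MathematicalPhysics.StatisticalMechanics
open Literature.Probability.PointProcesses (ballPattern)
open Summit.AtomisticToContinuum.Crystallization.Theses.FrustrationRangeCertificates

/-- The route's pattern map `pat` (as inlined in `PatternPricedCertificates`) is the Literature's
`relPattern`. [folklore] -/
theorem transferDuality_relPattern_eq (L : ℝ) {N : ℕ} (x : Fin N → EuclideanSpace ℝ (Fin 3))
    (i : Fin N) :
    relPattern L x i = Finset.image (fun k : Fin N => x k - x i)
      (Finset.univ.filter fun k : Fin N => k ≠ i ∧ dist (x i) (x k) ≤ L) :=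
  rfl

/-- **Weak duality, finite volume (unbounded-range transfers).** If a transfer rule `Φ`
certifies the constant `c` with price `κ` on the bad particles of a finite configuration `x` —
the pointwise inequality of `PatternPricedCertificates` at every particle, for an arbitrary
pattern assignment `pat` and an arbitrary defect predicate `bad` — then `N·c + κ·#bad ≤ 𝓔_N(x)`:
the transfers are zero-sum and the half site energies add up to the interaction energy.
[folklore; LP weak duality — cf. `IsTransferCertificate.mul_le_sum` for finite-range rules] -/
theorem transferDuality_weak_finite {N : ℕ} (V : ℝ → ℝ) (x : Fin N → EuclideanSpace ℝ (Fin 3))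
    (pat : Fin N → Finset (EuclideanSpace ℝ (Fin 3)))
    (Φ : EuclideanSpace ℝ (Fin 3) → Finset (EuclideanSpace ℝ (Fin 3)) →
      Finset (EuclideanSpace ℝ (Fin 3)) → ℝ)
    (bad : Fin N → Prop) (c κ : ℝ)
    (h : ∀ i : Fin N, c + (if bad i then κ else 0) ≤
      (∑ j ∈ Finset.univ.erase i, V (dist (x i) (x j))) / 2 +
        ∑ j ∈ Finset.univ.erase i, (Φ (x j - x i) (pat i) (pat j) - Φ (x i - x j) (pat j) (pat i))) :
    (N : ℝ) * c + κ * (Nat.card {i : Fin N // bad i} : ℝ) ≤ interactionEnergy V x := by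
  have hs := (Finset.sum_le_sum fun i _ => h i).trans_eq
    (certificatesDefectVanish_sum_rhs V x pat Φ)
  simp only [Finset.sum_add_distrib, Finset.sum_const, Finset.card_univ, Fintype.card_fin,
    nsmul_eq_mul, Finset.sum_ite] at hs
  rw [Nat.card_eq_fintype_card, Fintype.card_subtype]
  linarith

/-- Dividing by `N ≥ 1`: a certified constant plus `κ` times the defect fraction is at most the
energy per particle of any finite configuration on which the certificate holds — the dual value
is bounded by the primal value at the uniformly rooted empirical law. [folklore] -/
theorem transferDuality_weak_finite_div {N : ℕ} (hN : 0 < N) (V : ℝ → ℝ)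
    (x : Fin N → EuclideanSpace ℝ (Fin 3)) (pat : Fin N → Finset (EuclideanSpace ℝ (Fin 3)))
    (Φ : EuclideanSpace ℝ (Fin 3) → Finset (EuclideanSpace ℝ (Fin 3)) →
      Finset (EuclideanSpace ℝ (Fin 3)) → ℝ)
    (bad : Fin N → Prop) (c κ : ℝ)
    (h : ∀ i : Fin N, c + (if bad i then κ else 0) ≤
      (∑ j ∈ Finset.univ.erase i, V (dist (x i) (x j))) / 2 +
        ∑ j ∈ Finset.univ.erase i, (Φ (x j - x i) (pat i) (pat j) - Φ (x i - x j) (pat j) (pat i))) :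
    c + κ * ((Nat.card {i : Fin N // bad i} : ℝ) / N) ≤ interactionEnergy V x / N := by
  have hNr : (0 : ℝ) < N := by exact_mod_cast hN
  have hw := transferDuality_weak_finite V x pat Φ bad c κ h
  rw [le_div_iff₀ hNr, add_mul, mul_assoc, div_mul_cancel₀ _ hNr.ne']
  linarith

/-- **Level monotonicity of unbounded-range transfer certificates.** Whatever is certified from
level-`L` patterns — a pointwise bound `lhs i ≤ ½·(site energy of i) + (transfer balance of i)`
at every particle of every admissible finite configuration, the transfers being computed by a
rule `Φ` from the displacement and the two `L`-patterns — is certified from level-`L'` patterns,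
`L ≤ L'`, by the rule `Φ' (v, p, q) := Φ (v, ballPattern L p, ballPattern L q)`, since the
`L`-pattern is the `L'`-pattern cut down to the closed ball of radius `L`
(`ballPattern_relPattern`). In particular the dual values `v_L(κ)` of the item are
non-decreasing in `L`. [folklore; cf. `IsTransferCertificate.extend` for finite-range rules] -/
theorem transferDuality_level_mono {L L' : ℝ} (hLL' : L ≤ L') (V : ℝ → ℝ)
    (adm : (N : ℕ) → (Fin N → EuclideanSpace ℝ (Fin 3)) → Prop)
    (lhs : (N : ℕ) → (Fin N → EuclideanSpace ℝ (Fin 3)) → Fin N → ℝ)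
    (Φ : EuclideanSpace ℝ (Fin 3) → Finset (EuclideanSpace ℝ (Fin 3)) →
      Finset (EuclideanSpace ℝ (Fin 3)) → ℝ)
    (hΦ : ∀ (N : ℕ) (x : Fin N → EuclideanSpace ℝ (Fin 3)), adm N x → ∀ i : Fin N, lhs N x i ≤
        (∑ j ∈ Finset.univ.erase i, V (dist (x i) (x j))) / 2 +
          ∑ j ∈ Finset.univ.erase i, (Φ (x j - x i) (relPattern L x i) (relPattern L x j) -
            Φ (x i - x j) (relPattern L x j) (relPattern L x i)))
    (N : ℕ) (x : Fin N → EuclideanSpace ℝ (Fin 3)) (hx : adm N x) (i : Fin N) :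
    lhs N x i ≤ (∑ j ∈ Finset.univ.erase i, V (dist (x i) (x j))) / 2 +
      ∑ j ∈ Finset.univ.erase i,
        (Φ (x j - x i) (ballPattern L (relPattern L' x i)) (ballPattern L (relPattern L' x j)) -
          Φ (x i - x j) (ballPattern L (relPattern L' x j)) (ballPattern L (relPattern L' x i))) := by
  simp only [ballPattern_relPattern hLL']
  exact hΦ N x hx i

/-- `transferDuality_level_mono` in the literal vocabulary of the route file (patterns as the
`let pat := …` of `PatternPricedCertificates`, the cut-down rule written out as a filter).
[folklore] -/
theorem transferDuality_level_mono' {L L' : ℝ} (hLL' : L ≤ L') (V : ℝ → ℝ)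
    (adm : (N : ℕ) → (Fin N → EuclideanSpace ℝ (Fin 3)) → Prop)
    (lhs : (N : ℕ) → (Fin N → EuclideanSpace ℝ (Fin 3)) → Fin N → ℝ)
    (Φ : EuclideanSpace ℝ (Fin 3) → Finset (EuclideanSpace ℝ (Fin 3)) →
      Finset (EuclideanSpace ℝ (Fin 3)) → ℝ)
    (hΦ : ∀ (N : ℕ) (x : Fin N → EuclideanSpace ℝ (Fin 3)), adm N x →
      let pat : Fin N → Finset (EuclideanSpace ℝ (Fin 3)) := fun i =>
        Finset.image (fun k : Fin N => x k - x i)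
          (Finset.univ.filter fun k : Fin N => k ≠ i ∧ dist (x i) (x k) ≤ L)
      ∀ i : Fin N, lhs N x i ≤
        (∑ j ∈ Finset.univ.erase i, V (dist (x i) (x j))) / 2 +
          ∑ j ∈ Finset.univ.erase i,
            (Φ (x j - x i) (pat i) (pat j) - Φ (x i - x j) (pat j) (pat i))) :
    ∀ (N : ℕ) (x : Fin N → EuclideanSpace ℝ (Fin 3)), adm N x →
      let pat : Fin N → Finset (EuclideanSpace ℝ (Fin 3)) := fun i =>
        Finset.image (fun k : Fin N => x k - x i)
          (Finset.univ.filter fun k : Fin N => k ≠ i ∧ dist (x i) (x k) ≤ L')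
      ∀ i : Fin N, lhs N x i ≤
        (∑ j ∈ Finset.univ.erase i, V (dist (x i) (x j))) / 2 +
          ∑ j ∈ Finset.univ.erase i,
            ((fun v p q => Φ v (p.filter fun w => ‖w‖ ≤ L) (q.filter fun w => ‖w‖ ≤ L))
                (x j - x i) (pat i) (pat j) -
              (fun v p q => Φ v (p.filter fun w => ‖w‖ ≤ L) (q.filter fun w => ‖w‖ ≤ L))
                (x i - x j) (pat j) (pat i)) :=
  fun N x hx i => transferDuality_level_mono hLL' V adm lhs Φ hΦ N x hx i

/-- **Cutting a rule at range `L`** reproduces the Literature's finite-range balance as an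
unbounded-range balance: with `Φ_cut (v, p, q) := if ‖v‖ ≤ L then Φ (v, p, q) else 0`,
`transferSum L Φ x i = Σ_{j ≠ i} [Φ_cut(x_j − x_i, P_L i, P_L j) − Φ_cut(x_i − x_j, P_L j, P_L i)]`.
[folklore] -/
theorem transferDuality_transferSum_eq_cut (L : ℝ)
    (Φ : EuclideanSpace ℝ (Fin 3) → Finset (EuclideanSpace ℝ (Fin 3)) →
      Finset (EuclideanSpace ℝ (Fin 3)) → ℝ)
    {N : ℕ} (x : Fin N → EuclideanSpace ℝ (Fin 3)) (i : Fin N) :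
    transferSum L Φ x i = ∑ j ∈ Finset.univ.erase i,
      ((fun v p q => if ‖v‖ ≤ L then Φ v p q else 0) (x j - x i) (relPattern L x i)
          (relPattern L x j) -
        (fun v p q => if ‖v‖ ≤ L then Φ v p q else 0) (x i - x j) (relPattern L x j)
          (relPattern L x i)) := by
  unfold transferSum
  refine Finset.sum_congr rfl fun j _ => ?_
  have hn : ‖x j - x i‖ = dist (x i) (x j) := by rw [← dist_eq_norm, dist_comm]
  have hn' : ‖x i - x j‖ = dist (x i) (x j) := by rw [← dist_eq_norm]
  by_cases h : dist (x i) (x j) ≤ L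
  · simp only [if_pos h, hn, hn']
  · simp only [if_neg h, hn, hn', sub_zero]

/-- **Finite-range certificates are route certificates.** A pointwise bound certified with the
Literature's range-`L` balance `transferSum L Φ` (as in `IsTransferCertificate`) is certified in
the route's unbounded-range form at level `L` by the cut rule; hence every constant below
`transferLevelValue f δ L`, `f = ½·(site energy) − (price on bad particles)`, is a level-`L`
dual-feasible constant of the item. [folklore] -/
theorem transferDuality_of_finiteRange {L : ℝ} (V : ℝ → ℝ)
    (adm : (N : ℕ) → (Fin N → EuclideanSpace ℝ (Fin 3)) → Prop)
    (lhs : (N : ℕ) → (Fin N → EuclideanSpace ℝ (Fin 3)) → Fin N → ℝ)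
    (Φ : EuclideanSpace ℝ (Fin 3) → Finset (EuclideanSpace ℝ (Fin 3)) →
      Finset (EuclideanSpace ℝ (Fin 3)) → ℝ)
    (hΦ : ∀ (N : ℕ) (x : Fin N → EuclideanSpace ℝ (Fin 3)), adm N x → ∀ i : Fin N, lhs N x i ≤
        (∑ j ∈ Finset.univ.erase i, V (dist (x i) (x j))) / 2 + transferSum L Φ x i)
    (N : ℕ) (x : Fin N → EuclideanSpace ℝ (Fin 3)) (hx : adm N x) (i : Fin N) :
    lhs N x i ≤ (∑ j ∈ Finset.univ.erase i, V (dist (x i) (x j))) / 2 +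
      ∑ j ∈ Finset.univ.erase i,
        ((fun v p q => if ‖v‖ ≤ L then Φ v p q else 0) (x j - x i) (relPattern L x i)
            (relPattern L x j) -
          (fun v p q => if ‖v‖ ≤ L then Φ v p q else 0) (x i - x j) (relPattern L x j)
            (relPattern L x i)) := by
  rw [← transferDuality_transferSum_eq_cut]
  exact hΦ N x hx i

end Summit.AtomisticToContinuum.Crystallization.Theorems
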